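import Mathlib
import Summits.Ventures.HodgeRepro.Tier4.Target
import Summits.Ventures.HodgeRepro.Tier4.Line3.Defs
import Summits.Ventures.HodgeRepro.Tier4.Line3.DefsLemmas
import Summits.Ventures.HodgeRepro.Tier4.Line3.KMDatumS
import Summits.Ventures.HodgeRepro.Tier4.Line3.MajorantLemmas
import Summits.Ventures.HodgeRepro.Tier4.Line3.Witness.Coercive
import Summits.Ventures.HodgeRepro.Tier4.Line3.Witness.ThetaDataWitnessCf
import Summits.Ventures.HodgeRepro.Tier4.Line3.Witness.MajCoercive
import Summits.Ventures.HodgeRepro.Tier4.Line3.Witness.PhiDel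
import Summits.Ventures.HodgeRepro.Tier4.Line3.Witness.LatticeGauss

/-!
# Tier4/Line3/Witness/SummandBound — the uniform Gaussian bound of the summands of the witness theta series (the analytic half of the `summable` clause of the R4 witness of LINE L3's `ThetaData`)
(seat t4-L2-p2, gen 0, on t4-plan-3's word S12460 (i); blind re-derivation cell `pub-hodge-repro`, Tier 4, README §9–§10)

The companion `ThetaDataWitnessSummable.lean` proves `cfW_summable`: for EVERY Kudla–Millson datum `Φ : KMDatumS`, every slot `j`, every compact `K ⊆ 𝔹` and every `k`,
the summands `cfW j (x_o) · Φ(y(x_o), z)_k` of the theta series of the cf-side witness (`Witness/ThetaDataWitnessCf.lean`)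
have a majorant `g : Line → ℝ`, summable, uniform in `z ∈ K` — the clause `ThetaData.summable` for `cf := cfW`.

THE MAJORANT.  On `K`: the entries of `A_k(z)` are bounded (`cont` on the compact `K`, `CA`), and the majorant is
coercive, `maj y z ≥ κ Σ ‖y_i‖²` with `κ = (1 − max_K |z|²)/4` (`Witness/MajCoercive.lean`).  Hence
`‖Φ(y, z)_k‖ ≤ 3 CA Y e^{−πκY} ≤ 3 CA (2/(πκ)) e^{−πκY/2}` (`Y = Σ ‖y_i‖²`), and `Y ≥ Σ_i ‖τ₀ x_i‖² / NC` because
`τ₀ x = C y` (`sum_sq_tau_le`); the coefficient `‖cfW j x‖ ≤ gaussDef x ≤ exp (−c₀ Σ_{σ def} Σ_i ‖σ x_i‖²)`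
(`gaussDef_le_exp`, coercivity of the definite `H_σ`).  Together (`summand_le`):
`‖cfW j x · Φ(y(x), z)_k‖ ≤ K₀ · exp (−c Σ_{σ ≠ τ̄₀} Σ_i ‖σ x_i‖²) = K₀ ∏_i exp (−c Σ_{σ ≠ τ̄₀} ‖σ x_i‖²)`.
THE SUM.  The embeddings `σ ≠ τ̄₀` meet every conjugate pair (`allSet_meets`; `τ̄₀ ≠ τ₀` as `E′` is CM), so the
Gaussian is summable over `𝓞_{E′}` (`Witness/LatticeGauss.lean`), over `𝓞³ = Lstd` (`summable_pi_prod`, the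
injection `toInt`), and over the lines: a line with `cfW ≠ 0` has a norm-one multiple of its representative in `Lstd`
(`cfW`'s condition), the map line ↦ that lattice point is injective (two such points on the same line differ by a
norm-one scalar), and both factors of the summand are invariant under the norm-one scalars (`cfW_weight`,
`datumS_ballCoord_smul`), so the majorant pulled back to the lines (zero elsewhere) is summable.

Mathlib + the line's definitions + the landed support modules; no printed input.  Nothing here says anything about the
status of the Hodge conjecture for CM abelian varieties, which is NOT proved (HC_CM is NOT proved by anyone in this
repository).
-/

set_option autoImplicit false

noncomputable section

namespace Summit.Ventures.HodgeRepro.Tier4.Line3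

open Summit.Ventures.HodgeRepro.Tier4
open Matrix NumberField
open scoped ComplexConjugate ComplexOrder Classical


/-! ### Analytic bounds for the summand -/

/-- `|ȳ A y| ≤ (max_{ij} ‖A_{ij}‖ bound) · 3 Σ_i ‖y_i‖²`: with every entry bounded by `CA`. -/
theorem norm_quad_le (A : Matrix (Fin 3) (Fin 3) ℂ) (CA : ℝ) (hA : ∀ i j, ‖A i j‖ ≤ CA) (y : Fin 3 → ℂ) :
    ‖star y ⬝ᵥ (A *ᵥ y)‖ ≤ 3 * CA * ∑ i, ‖y i‖ ^ 2 := by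
  have hCA : 0 ≤ CA := (norm_nonneg _).trans (hA 0 0)
  have hterm : ∀ i j, ‖star y i * (A i j * y j)‖ ≤ CA * ((‖y i‖ ^ 2 + ‖y j‖ ^ 2) / 2) := by
    intro i j
    rw [norm_mul, norm_mul, Pi.star_apply, norm_star]
    calc ‖y i‖ * (‖A i j‖ * ‖y j‖) ≤ ‖y i‖ * (CA * ‖y j‖) := by gcongr; exact hA i j
      _ = CA * (‖y i‖ * ‖y j‖) := by ring
      _ ≤ CA * ((‖y i‖ ^ 2 + ‖y j‖ ^ 2) / 2) := by
          gcongr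
          nlinarith [sq_nonneg (‖y i‖ - ‖y j‖)]
  calc ‖star y ⬝ᵥ (A *ᵥ y)‖ = ‖∑ i, star y i * ∑ j, A i j * y j‖ := by
        simp only [dotProduct, Matrix.mulVec]
    _ ≤ ∑ i, ∑ j, ‖star y i * (A i j * y j)‖ := by
        refine (norm_sum_le _ _).trans (Finset.sum_le_sum fun i _ => ?_)
        rw [Finset.mul_sum]
        exact norm_sum_le _ _
    _ ≤ ∑ i, ∑ j, CA * ((‖y i‖ ^ 2 + ‖y j‖ ^ 2) / 2) :=
        Finset.sum_le_sum fun i _ => Finset.sum_le_sum fun j _ => hterm i j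
    _ = 3 * CA * ∑ i, ‖y i‖ ^ 2 := by
        simp only [Fin.sum_univ_three]
        ring

/-- `Y e^{−aY} ≤ (2/a) e^{−aY/2}` for `a > 0`, `Y ≥ 0`. -/
theorem mul_exp_neg_le (a : ℝ) (ha : 0 < a) (Y : ℝ) :
    Y * Real.exp (-(a * Y)) ≤ 2 / a * Real.exp (-(a * Y / 2)) := by
  have h1 : a * Y / 2 ≤ Real.exp (a * Y / 2) := by
    have := Real.add_one_le_exp (a * Y / 2)
    linarith
  have h2 : Y ≤ 2 / a * Real.exp (a * Y / 2) := by
    rw [div_mul_eq_mul_div, le_div_iff₀ ha]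
    linarith
  calc Y * Real.exp (-(a * Y)) ≤ 2 / a * Real.exp (a * Y / 2) * Real.exp (-(a * Y)) := by
        gcongr
    _ = 2 / a * Real.exp (-(a * Y / 2)) := by
        rw [mul_assoc, ← Real.exp_add]
        congr 2
        ring

namespace T4Data

variable (X : T4Data)

/-- The ball coordinates scale by `τ₀ t` under `t`. -/
theorem ballCoord_smul_w (t : X.E) (x : Fin 3 → X.E) : X.ballCoord (t • x) = X.τ₀ t • X.ballCoord x := by
  unfold ballCoord
  rw [← Matrix.mulVec_smul]
  congr 1
  funext i
  simp [Pi.smul_apply, smul_eq_mul, map_mul]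

/-- The datum at the ball coordinates is invariant under the norm-one scalars. -/
theorem datumS_ballCoord_smul (Φ : KMDatumS) {t : X.E} (ht : X.c t * t = 1) (x : Fin 3 → X.E)
    (z : Fin 2 → ℂ) (k : Fin 2) :
    datumS Φ (X.ballCoord (t • x)) z k = datumS Φ (X.ballCoord x) z k := by
  rw [ballCoord_smul_w]
  refine datumS_smul Φ _ ?_ _ _ _
  have h := X.conj_mul_self_of_norm_one X.τ₀ ht
  have h2 : ‖X.τ₀ t‖ ^ 2 = 1 := by
    have := congrArg Complex.re h
    rw [Complex.conj_mul'] at this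
    exact_mod_cast this
  exact (pow_eq_one_iff_of_nonneg (norm_nonneg _) two_ne_zero).mp h2

/-- The coordinates `τ₀ x` are controlled by the ball coordinates: `Σ_i ‖τ₀ x_i‖² ≤ NC · Σ_i ‖y_i‖²` with
`NC = 9 (Σ_{ij} ‖C_{ij}‖)² + 1`. -/
theorem sum_sq_tau_le (x : Fin 3 → X.E) :
    ∑ i, ‖X.τ₀ (x i)‖ ^ 2 ≤ (9 * (∑ i, ∑ j, ‖X.C i j‖) ^ 2 + 1) * ∑ i, ‖X.ballCoord x i‖ ^ 2 := by
  set y := X.ballCoord x with hy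
  set MC := ∑ i, ∑ j, ‖X.C i j‖ with hMC
  have hMC0 : 0 ≤ MC := by positivity
  have hC : IsUnit X.C := X.hC.1
  have hxy : (fun i => X.τ₀ (x i)) = X.C *ᵥ y := by
    rw [hy, ballCoord, Matrix.mulVec_mulVec, Matrix.mul_nonsing_inv _ ((Matrix.isUnit_iff_isUnit_det _).mp hC),
      Matrix.one_mulVec]
  have hentry : ∀ i j, ‖X.C i j‖ ≤ MC := fun i j => by
    rw [hMC]
    calc ‖X.C i j‖ ≤ ∑ j', ‖X.C i j'‖ := Finset.single_le_sum (fun _ _ => norm_nonneg _) (Finset.mem_univ j)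
      _ ≤ ∑ i', ∑ j', ‖X.C i' j'‖ := Finset.single_le_sum (fun _ _ => Finset.sum_nonneg fun _ _ => norm_nonneg _)
          (Finset.mem_univ i)
  have hrow : ∀ i, ‖(X.C *ᵥ y) i‖ ≤ MC * ∑ j, ‖y j‖ := fun i => by
    simp only [Matrix.mulVec, dotProduct]
    refine (norm_sum_le _ _).trans ?_
    rw [Finset.mul_sum]
    refine Finset.sum_le_sum fun j _ => ?_
    rw [norm_mul]
    gcongr
    exact hentry i j
  have hsq : (∑ j, ‖y j‖) ^ 2 ≤ 3 * ∑ j, ‖y j‖ ^ 2 := by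
    simp only [Fin.sum_univ_three]
    nlinarith [sq_nonneg (‖y 0‖ - ‖y 1‖), sq_nonneg (‖y 1‖ - ‖y 2‖), sq_nonneg (‖y 0‖ - ‖y 2‖)]
  have hY0 : 0 ≤ ∑ j, ‖y j‖ ^ 2 := Finset.sum_nonneg fun _ _ => sq_nonneg _
  calc ∑ i, ‖X.τ₀ (x i)‖ ^ 2 = ∑ i, ‖(X.C *ᵥ y) i‖ ^ 2 := by
        refine Finset.sum_congr rfl fun i _ => ?_
        rw [show X.τ₀ (x i) = (fun i => X.τ₀ (x i)) i from rfl, hxy]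
    _ ≤ ∑ i : Fin 3, (MC * ∑ j, ‖y j‖) ^ 2 := Finset.sum_le_sum fun i _ => by
        gcongr
        exact hrow i
    _ = 3 * (MC ^ 2 * (∑ j, ‖y j‖) ^ 2) := by
        simp only [Finset.sum_const, Finset.card_univ, Fintype.card_fin, nsmul_eq_mul]
        push_cast
        ring
    _ ≤ 3 * (MC ^ 2 * (3 * ∑ j, ‖y j‖ ^ 2)) := by gcongr
    _ ≤ (9 * MC ^ 2 + 1) * ∑ i, ‖y i‖ ^ 2 := by nlinarith [mul_nonneg (sq_nonneg MC) hY0]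


/-! ### The embeddings meeting every conjugate pair: all but `τ̄₀` -/

/-- `conj ∘ σ` is Mathlib's `ComplexEmbedding.conjugate σ`. -/
theorem conjEmb_eq_conjugate (σ : X.E →+* ℂ) : conjEmb σ = ComplexEmbedding.conjugate σ := by
  ext x
  rw [ComplexEmbedding.conjugate_coe_eq]
  rfl

/-- A CM field has no real embedding: `τ̄₀ ≠ τ₀`. -/
theorem conjEmb_tau_ne : conjEmb X.τ₀ ≠ X.τ₀ := by
  intro h
  apply IsTotallyComplex.complexEmbedding_not_isReal (K := X.E) X.τ₀
  rw [ComplexEmbedding.isReal_iff, ← conjEmb_eq_conjugate]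
  exact h

/-- The definite embeddings. -/
def defSet : Finset (X.E →+* ℂ) := Finset.univ.filter fun σ => σ ≠ X.τ₀ ∧ σ ≠ conjEmb X.τ₀

/-- All embeddings but `τ̄₀` (= `{τ₀} ∪ defSet`). -/
def allSet : Finset (X.E →+* ℂ) := Finset.univ.filter fun σ => σ ≠ conjEmb X.τ₀

/-- `allSet = {τ₀} ∪ defSet`. -/
theorem allSet_eq : X.allSet = insert X.τ₀ X.defSet := by
  ext σ
  simp only [allSet, defSet, Finset.mem_filter, Finset.mem_univ, true_and, Finset.mem_insert]
  constructor
  · intro h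
    by_cases hσ : σ = X.τ₀
    · exact Or.inl hσ
    · exact Or.inr ⟨hσ, h⟩
  · rintro (rfl | ⟨-, h⟩)
    · exact X.conjEmb_tau_ne.symm
    · exact h

/-- `τ₀` is not definite. -/
theorem tau_notMem_defSet : X.τ₀ ∉ X.defSet := by
  simp [defSet]

/-- `allSet` meets every conjugate pair. -/
theorem allSet_meets (φ : X.E →+* ℂ) : φ ∈ X.allSet ∨ ComplexEmbedding.conjugate φ ∈ X.allSet := by
  by_cases h : φ = conjEmb X.τ₀
  · right
    rw [h, ← conjEmb_eq_conjugate]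
    have : conjEmb (conjEmb X.τ₀) = X.τ₀ := by
      ext x
      simp [conjEmb]
    rw [this]
    simp [allSet, X.conjEmb_tau_ne.symm]
  · left
    simp [allSet, h]

/-- The Gaussian of the definite places in exponential form: `gaussDef x ≤ exp (−c₀ Σ_{σ def} Σ_i ‖σ x_i‖²)`. -/
theorem gaussDef_le_exp (x : Fin 3 → X.E) :
    X.gaussDef x ≤ Real.exp (-(X.c₀W * ∑ σ ∈ X.defSet, ∑ i, ‖σ (x i)‖ ^ 2)) := by
  unfold gaussDef
  rw [finprod_cond_eq_prod_of_cond_iff _ (t := X.defSet) (fun _ => by simp [defSet])]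
  calc ∏ σ ∈ X.defSet,
        Real.exp (-(Real.pi * |(star (fun i => σ (x i)) ⬝ᵥ ((X.H.map σ) *ᵥ (fun i => σ (x i)))).re|))
      ≤ ∏ σ ∈ X.defSet, Real.exp (-(X.c₀W * ∑ i, ‖σ (x i)‖ ^ 2)) := by
        refine Finset.prod_le_prod (fun _ _ => (Real.exp_pos _).le) fun σ hσ => ?_
        simp only [defSet, Finset.mem_filter, Finset.mem_univ, true_and] at hσ
        rw [Real.exp_le_exp, neg_le_neg_iff]
        calc X.c₀W * ∑ i, ‖σ (x i)‖ ^ 2 ≤ Real.pi * X.lamAll σ * ∑ i, ‖σ (x i)‖ ^ 2 := by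
              gcongr
              exact X.c₀W_le σ
          _ = Real.pi * (X.lamAll σ * ∑ i, ‖σ (x i)‖ ^ 2) := by ring
          _ ≤ Real.pi * |(star (fun i => σ (x i)) ⬝ᵥ ((X.H.map σ) *ᵥ (fun i => σ (x i)))).re| := by
              gcongr
              exact X.lamAll_spec σ hσ.1 hσ.2 _
    _ = Real.exp (-(X.c₀W * ∑ σ ∈ X.defSet, ∑ i, ‖σ (x i)‖ ^ 2)) := by
        rw [← Real.exp_sum, Finset.mul_sum, Finset.sum_neg_distrib]

/-- The norm bound constant of the ball coordinates. -/
def NC : ℝ := 9 * (∑ i, ∑ j, ‖X.C i j‖) ^ 2 + 1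

/-- `0 < NC`. -/
theorem NC_pos : 0 < X.NC := by unfold NC; positivity

/-- The decay constant of the summand on a compact of the ball with majorant constant `κ`. -/
def cW (κ : ℝ) : ℝ := min X.c₀W (Real.pi * κ / (2 * X.NC))

/-- `0 < c`. -/
theorem cW_pos {κ : ℝ} (hκ : 0 < κ) : 0 < X.cW κ :=
  lt_min X.c₀W_pos (by have := X.NC_pos; positivity)

/-- **The summand bound**: at `z` with `‖A_k(z)_{ij}‖ ≤ CA` and `maj y z ≥ κ Σ ‖y_i‖²`,
`‖cfW x · Φ(y(x), z)_k‖ ≤ 3 CA (2/(πκ)) · exp (−c Σ_{σ ∈ allSet} Σ_i ‖σ x_i‖²)`. -/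
theorem summand_le (Φ : KMDatumS) (k : Fin 2) {CA κ : ℝ} (hCA : 0 ≤ CA) (hκ : 0 < κ) {z : Fin 2 → ℂ}
    (hA : ∀ i j, ‖Φ.A z k i j‖ ≤ CA) (hmaj : ∀ y : Fin 3 → ℂ, κ * ∑ i, ‖y i‖ ^ 2 ≤ maj y z)
    (j : Fin 4) (x : Fin 3 → X.E) :
    ‖X.cfW j x * datumS Φ (X.ballCoord x) z k‖ ≤
      3 * CA * (2 / (Real.pi * κ)) * Real.exp (-(X.cW κ * ∑ σ ∈ X.allSet, ∑ i, ‖σ (x i)‖ ^ 2)) := by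
  set y := X.ballCoord x with hy
  set Y := ∑ i, ‖y i‖ ^ 2 with hY
  have hY0 : 0 ≤ Y := Finset.sum_nonneg fun _ _ => sq_nonneg _
  set T := ∑ i, ‖X.τ₀ (x i)‖ ^ 2 with hT
  have hT0 : 0 ≤ T := Finset.sum_nonneg fun _ _ => sq_nonneg _
  have hTY : T ≤ X.NC * Y := X.sum_sq_tau_le x
  set Sd := ∑ σ ∈ X.defSet, ∑ i, ‖σ (x i)‖ ^ 2 with hSd
  have hSd0 : 0 ≤ Sd := Finset.sum_nonneg fun _ _ => Finset.sum_nonneg fun _ _ => sq_nonneg _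
  have hsplit : ∑ σ ∈ X.allSet, ∑ i, ‖σ (x i)‖ ^ 2 = T + Sd := by
    rw [allSet_eq, Finset.sum_insert X.tau_notMem_defSet]
  -- the coefficient factor
  have hcf : ‖X.cfW j x‖ ≤ Real.exp (-(X.c₀W * Sd)) := by
    refine le_trans ?_ (X.gaussDef_le_exp x)
    unfold cfW
    split_ifs
    · rw [Complex.norm_real, Real.norm_eq_abs, abs_of_pos (X.gaussDef_pos x)]
    · rw [norm_zero]
      exact (X.gaussDef_pos x).le
  -- the datum factor
  have hdat : ‖datumS Φ y z k‖ ≤ 3 * CA * (2 / (Real.pi * κ)) * Real.exp (-(Real.pi * κ * Y / 2)) := by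
    unfold datumS
    rw [norm_mul, Complex.norm_real, Real.norm_eq_abs, abs_of_pos (Real.exp_pos _)]
    have h1 : ‖star y ⬝ᵥ (Φ.A z k *ᵥ y)‖ ≤ 3 * CA * Y := norm_quad_le _ CA hA y
    have h2 : Real.exp (-Real.pi * maj y z) ≤ Real.exp (-(Real.pi * κ * Y)) := by
      rw [Real.exp_le_exp]
      have := hmaj y
      nlinarith [Real.pi_pos]
    have hK1 : 0 ≤ 3 * CA := by positivity
    calc ‖star y ⬝ᵥ (Φ.A z k *ᵥ y)‖ * Real.exp (-Real.pi * maj y z)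
        ≤ 3 * CA * Y * Real.exp (-(Real.pi * κ * Y)) :=
          mul_le_mul h1 h2 (Real.exp_pos _).le (by positivity)
      _ = 3 * CA * (Y * Real.exp (-(Real.pi * κ * Y))) := by ring
      _ ≤ 3 * CA * (2 / (Real.pi * κ) * Real.exp (-(Real.pi * κ * Y / 2))) :=
          mul_le_mul_of_nonneg_left (mul_exp_neg_le (Real.pi * κ) (by positivity) Y) hK1
      _ = 3 * CA * (2 / (Real.pi * κ)) * Real.exp (-(Real.pi * κ * Y / 2)) := by ring
  have hc1 : X.cW κ ≤ X.c₀W := min_le_left _ _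
  have hc2 : X.cW κ ≤ Real.pi * κ / (2 * X.NC) := min_le_right _ _
  have hcpos := X.cW_pos hκ
  have hNC := X.NC_pos
  have hexp1 : Real.exp (-(X.c₀W * Sd)) ≤ Real.exp (-(X.cW κ * Sd)) := by
    rw [Real.exp_le_exp, neg_le_neg_iff]
    exact mul_le_mul_of_nonneg_right hc1 hSd0
  have hexp2 : Real.exp (-(Real.pi * κ * Y / 2)) ≤ Real.exp (-(X.cW κ * T)) := by
    rw [Real.exp_le_exp, neg_le_neg_iff]
    calc X.cW κ * T ≤ Real.pi * κ / (2 * X.NC) * (X.NC * Y) := mul_le_mul hc2 hTY hT0 (by positivity)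
      _ = Real.pi * κ * Y / 2 := by field_simp
  have hK0 : 0 ≤ 3 * CA * (2 / (Real.pi * κ)) := by positivity
  rw [norm_mul]
  calc ‖X.cfW j x‖ * ‖datumS Φ y z k‖
      ≤ Real.exp (-(X.c₀W * Sd)) * (3 * CA * (2 / (Real.pi * κ)) * Real.exp (-(Real.pi * κ * Y / 2))) :=
        mul_le_mul hcf hdat (norm_nonneg _) (Real.exp_pos _).le
    _ ≤ Real.exp (-(X.cW κ * Sd)) * (3 * CA * (2 / (Real.pi * κ)) * Real.exp (-(X.cW κ * T))) :=
        mul_le_mul hexp1 (mul_le_mul_of_nonneg_left hexp2 hK0) (by positivity) (Real.exp_pos _).le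
    _ = 3 * CA * (2 / (Real.pi * κ)) * Real.exp (-(X.cW κ * (T + Sd))) := by
        rw [mul_add, neg_add, Real.exp_add]
        ring
    _ = 3 * CA * (2 / (Real.pi * κ)) * Real.exp (-(X.cW κ * ∑ σ ∈ X.allSet, ∑ i, ‖σ (x i)‖ ^ 2)) := by
        rw [hsplit]


end T4Data

end Summit.Ventures.HodgeRepro.Tier4.Line3
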